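import Summits.Ventures.HodgeRepro2.PeterssonPairing

/-!
# The Petersson inner product on the compact quotient `Γ\𝔹²`

Kernel support for the blind cell pub-hodge-repro2 (seat p2), T5-ID §ID-4(b′): the `L²` inner product of
two weight-`k` forms on the compact quotient `S = Γ\𝔹²`,

  `⟨f, g⟩ := ∫_{Γ\𝔹²} f(z) \overline{g(z)} (1 − ‖z‖²)^k dμ(z)`,

taken against a measure `μ` on `Γ\𝔹²` (the invariant measure of the route is a hypothesis here: `μ`
finite on compacts and positive on open sets).  Proved: the inner product is hermitian, sesquilinear,
and POSITIVE DEFINITE — `⟨f, f⟩ > 0` for every continuous weight-`k` function `f` that is not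
identically zero on the ball, `⟨f, f⟩ = 0` iff `f = 0` on the ball.  This is the non-degeneracy of the
pairing behind «(ω, ω′)_{L²} ≠ 0» in N1: the `L²`-norm of a non-zero form does not vanish.
-/

namespace Summit.Ventures.HodgeRepro2.ShimuraData

open Complex MeasureTheory

variable {K : Type*} [Field K] [NumberField K] [NumberField.IsCMField K]
    {τ₁ : K →+* ℂ} {H : Matrix (Fin 3) (Fin 3) K} {Q : Matrix (Fin 3) (Fin 3) ℂ}
    (hQ : IsFrame K τ₁ H Q) (S : Subgroup (GL (Fin 3) K)) (hS : (S : Set (GL (Fin 3) K)) ⊆ unitaryGroup K H)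
    [MeasurableSpace (ballQuotient hQ S hS)] (μ : Measure (ballQuotient hQ S hS))

/-- The Petersson inner product `⟨f, g⟩ := ∫_{Γ\𝔹²} f \overline{g} (1 − ‖z‖²)^k dμ` of two weight-`k`
forms for `S`, against a measure `μ` on the quotient. -/
noncomputable def peterssonInner {k : ℕ} {f g : (Fin 2 → ℂ) → ℂ} (hf : IsWeightFor τ₁ Q S k f)
    (hg : IsWeightFor τ₁ Q S k g) : ℂ :=
  ∫ x, peterssonPairQuotient hQ S hS hf hg x ∂μ

/-- Hermitian symmetry: `⟨g, f⟩ = \overline{⟨f, g⟩}`. -/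
theorem peterssonInner_swap {k : ℕ} {f g : (Fin 2 → ℂ) → ℂ} (hf : IsWeightFor τ₁ Q S k f)
    (hg : IsWeightFor τ₁ Q S k g) :
    peterssonInner hQ S hS μ hg hf = (starRingEnd ℂ) (peterssonInner hQ S hS μ hf hg) := by
  unfold peterssonInner
  rw [← integral_conj]
  congr 1
  funext x
  exact peterssonPairQuotient_swap hQ S hS hf hg x

/-- `⟨f, f⟩` is the (real) integral of the Petersson density of row 88. -/
theorem peterssonInner_self {k : ℕ} {f : (Fin 2 → ℂ) → ℂ} (hf : IsWeightFor τ₁ Q S k f) :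
    peterssonInner hQ S hS μ hf hf = ((∫ x, peterssonQuotient hQ S hS hf x ∂μ : ℝ) : ℂ) := by
  unfold peterssonInner
  have h : (fun x => peterssonPairQuotient hQ S hS hf hf x) =
      fun x => ((peterssonQuotient hQ S hS hf x : ℝ) : ℂ) :=
    funext (peterssonPairQuotient_self hQ S hS hf)
  rw [h]
  exact integral_ofReal

/-- `⟨f, f⟩` is real. -/
theorem peterssonInner_self_im {k : ℕ} {f : (Fin 2 → ℂ) → ℂ} (hf : IsWeightFor τ₁ Q S k f) :
    (peterssonInner hQ S hS μ hf hf).im = 0 := by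
  rw [peterssonInner_self, Complex.ofReal_im]

/-- Homogeneity in the first variable (no integrability needed). -/
theorem peterssonInner_smul_left {k : ℕ} (c : ℂ) {f g : (Fin 2 → ℂ) → ℂ} (hf : IsWeightFor τ₁ Q S k f)
    (hg : IsWeightFor τ₁ Q S k g) :
    peterssonInner hQ S hS μ (hf.smul c) hg = c * peterssonInner hQ S hS μ hf hg := by
  unfold peterssonInner
  rw [← integral_const_mul]
  congr 1
  funext x
  obtain ⟨z, rfl⟩ := ballQuotient_mk_surjective hQ S hS x
  rw [peterssonPairQuotient_mk, peterssonPairQuotient_mk, peterssonPair_smul_left]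

/-- Conjugate-homogeneity in the second variable (no integrability needed). -/
theorem peterssonInner_smul_right {k : ℕ} (c : ℂ) {f g : (Fin 2 → ℂ) → ℂ} (hf : IsWeightFor τ₁ Q S k f)
    (hg : IsWeightFor τ₁ Q S k g) :
    peterssonInner hQ S hS μ hf (hg.smul c) = (starRingEnd ℂ) c * peterssonInner hQ S hS μ hf hg := by
  unfold peterssonInner
  rw [← integral_const_mul]
  congr 1
  funext x
  obtain ⟨z, rfl⟩ := ballQuotient_mk_surjective hQ S hS x
  rw [peterssonPairQuotient_mk, peterssonPairQuotient_mk, peterssonPair_smul_right]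

/-- The Petersson density is non-negative on the ball. -/
theorem petersson_nonneg (k : ℕ) (f : (Fin 2 → ℂ) → ℂ) {z : Fin 2 → ℂ} (hz : z ∈ ball₂) :
    0 ≤ petersson k f z := by
  unfold petersson
  have h1 : 0 ≤ 1 - normSq₂ z := sub_nonneg.mpr (normSq₂_lt_one hz).le
  positivity

/-- The Petersson density is non-zero exactly where `f` is. -/
theorem petersson_ne_zero_iff (k : ℕ) (f : (Fin 2 → ℂ) → ℂ) {z : Fin 2 → ℂ} (hz : z ∈ ball₂) :
    petersson k f z ≠ 0 ↔ f z ≠ 0 := by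
  unfold petersson
  have h1 : (1 - normSq₂ z) ^ k ≠ 0 := pow_ne_zero _ (sub_pos.mpr (normSq₂_lt_one hz)).ne'
  rw [mul_ne_zero_iff, pow_ne_zero_iff two_ne_zero, norm_ne_zero_iff]
  exact ⟨fun h => h.1, fun h => ⟨h, h1⟩⟩

omit [MeasurableSpace (ballQuotient hQ S hS)] in
/-- The descended Petersson density is non-negative. -/
theorem peterssonQuotient_nonneg {k : ℕ} {f : (Fin 2 → ℂ) → ℂ} (hf : IsWeightFor τ₁ Q S k f) :
    0 ≤ peterssonQuotient hQ S hS hf := by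
  intro x
  obtain ⟨z, rfl⟩ := ballQuotient_mk_surjective hQ S hS x
  rw [Pi.zero_apply, peterssonQuotient_mk]
  exact petersson_nonneg k f z.property

/-- If `f` vanishes on the ball, `⟨f, g⟩ = 0` for every `g`. -/
theorem peterssonInner_eq_zero_of_forall_eq_zero {k : ℕ} {f g : (Fin 2 → ℂ) → ℂ}
    (hf : IsWeightFor τ₁ Q S k f) (hg : IsWeightFor τ₁ Q S k g) (h0 : ∀ z ∈ ball₂, f z = 0) :
    peterssonInner hQ S hS μ hf hg = 0 := by
  unfold peterssonInner
  have : peterssonPairQuotient hQ S hS hf hg = 0 := by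
    funext x
    obtain ⟨z, rfl⟩ := ballQuotient_mk_surjective hQ S hS x
    rw [peterssonPairQuotient_mk, Pi.zero_apply]
    unfold peterssonPair
    rw [h0 z z.property, zero_mul, zero_mul]
  rw [this]
  exact integral_zero _ _

section Compact

variable [OpensMeasurableSpace (ballQuotient hQ S hS)] [CompactSpace (ballQuotient hQ S hS)]
  [IsFiniteMeasureOnCompacts μ]

/-- On the compact quotient the descended polarised density of two continuous weight-`k` forms is
integrable. -/
theorem integrable_peterssonPairQuotient {k : ℕ} {f g : (Fin 2 → ℂ) → ℂ} (hf : IsWeightFor τ₁ Q S k f)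
    (hg : IsWeightFor τ₁ Q S k g) (hfc : ContinuousOn f ball₂) (hgc : ContinuousOn g ball₂) :
    Integrable (peterssonPairQuotient hQ S hS hf hg) μ :=
  (continuous_peterssonPairQuotient hQ S hS hf hg hfc hgc).integrable_of_hasCompactSupport
    (HasCompactSupport.of_compactSpace _)

/-- On the compact quotient the descended Petersson density of a continuous weight-`k` form is
integrable. -/
theorem integrable_peterssonQuotient {k : ℕ} {f : (Fin 2 → ℂ) → ℂ} (hf : IsWeightFor τ₁ Q S k f)
    (hfc : ContinuousOn f ball₂) : Integrable (peterssonQuotient hQ S hS hf) μ :=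
  (continuous_peterssonQuotient hQ S hS hf hfc).integrable_of_hasCompactSupport
    (HasCompactSupport.of_compactSpace _)

/-- Additivity in the first variable (continuous forms on the compact quotient). -/
theorem peterssonInner_add_left {k : ℕ} {f₁ f₂ g : (Fin 2 → ℂ) → ℂ} (hf₁ : IsWeightFor τ₁ Q S k f₁)
    (hf₂ : IsWeightFor τ₁ Q S k f₂) (hg : IsWeightFor τ₁ Q S k g) (hfc₁ : ContinuousOn f₁ ball₂)
    (hfc₂ : ContinuousOn f₂ ball₂) (hgc : ContinuousOn g ball₂) :
    peterssonInner hQ S hS μ (hf₁.add hf₂) hg =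
      peterssonInner hQ S hS μ hf₁ hg + peterssonInner hQ S hS μ hf₂ hg := by
  unfold peterssonInner
  rw [← integral_add (integrable_peterssonPairQuotient hQ S hS μ hf₁ hg hfc₁ hgc)
    (integrable_peterssonPairQuotient hQ S hS μ hf₂ hg hfc₂ hgc)]
  congr 1
  funext x
  obtain ⟨z, rfl⟩ := ballQuotient_mk_surjective hQ S hS x
  rw [peterssonPairQuotient_mk, peterssonPairQuotient_mk, peterssonPairQuotient_mk,
    peterssonPair_add_left]

/-- Additivity in the second variable (continuous forms on the compact quotient). -/
theorem peterssonInner_add_right {k : ℕ} {f g₁ g₂ : (Fin 2 → ℂ) → ℂ} (hf : IsWeightFor τ₁ Q S k f)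
    (hg₁ : IsWeightFor τ₁ Q S k g₁) (hg₂ : IsWeightFor τ₁ Q S k g₂) (hfc : ContinuousOn f ball₂)
    (hgc₁ : ContinuousOn g₁ ball₂) (hgc₂ : ContinuousOn g₂ ball₂) :
    peterssonInner hQ S hS μ hf (hg₁.add hg₂) =
      peterssonInner hQ S hS μ hf hg₁ + peterssonInner hQ S hS μ hf hg₂ := by
  unfold peterssonInner
  rw [← integral_add (integrable_peterssonPairQuotient hQ S hS μ hf hg₁ hfc hgc₁)
    (integrable_peterssonPairQuotient hQ S hS μ hf hg₂ hfc hgc₂)]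
  congr 1
  funext x
  obtain ⟨z, rfl⟩ := ballQuotient_mk_surjective hQ S hS x
  rw [peterssonPairQuotient_mk, peterssonPairQuotient_mk, peterssonPairQuotient_mk,
    peterssonPair_add_right]

/-- **Positivity of the Petersson norm.** For `μ` positive on open sets and finite on compacts, the
integral of the Petersson density of a continuous weight-`k` form `f` over the compact quotient is
POSITIVE as soon as `f` does not vanish at one point of the ball. -/
theorem integral_peterssonQuotient_pos [μ.IsOpenPosMeasure] {k : ℕ} {f : (Fin 2 → ℂ) → ℂ}
    (hf : IsWeightFor τ₁ Q S k f) (hfc : ContinuousOn f ball₂) {z₀ : Fin 2 → ℂ} (hz₀ : z₀ ∈ ball₂)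
    (hne : f z₀ ≠ 0) : 0 < ∫ x, peterssonQuotient hQ S hS hf x ∂μ := by
  refine Continuous.integral_pos_of_hasCompactSupport_nonneg_nonzero
    (continuous_peterssonQuotient hQ S hS hf hfc) (HasCompactSupport.of_compactSpace _)
    (peterssonQuotient_nonneg hQ S hS hf) (x := ballQuotient.mk hQ S hS ⟨z₀, hz₀⟩) ?_
  rw [peterssonQuotient_mk]
  exact (petersson_ne_zero_iff k f hz₀).mpr hne

/-- **The Petersson inner product is positive definite**: `⟨f, f⟩` is a positive real number for every
continuous weight-`k` form `f` not vanishing identically on the ball. -/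
theorem peterssonInner_self_re_pos [μ.IsOpenPosMeasure] {k : ℕ} {f : (Fin 2 → ℂ) → ℂ}
    (hf : IsWeightFor τ₁ Q S k f) (hfc : ContinuousOn f ball₂) {z₀ : Fin 2 → ℂ} (hz₀ : z₀ ∈ ball₂)
    (hne : f z₀ ≠ 0) : 0 < (peterssonInner hQ S hS μ hf hf).re := by
  rw [peterssonInner_self, Complex.ofReal_re]
  exact integral_peterssonQuotient_pos hQ S hS μ hf hfc hz₀ hne

/-- `⟨f, f⟩ ≠ 0` for a continuous weight-`k` form not vanishing identically on the ball. -/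
theorem peterssonInner_self_ne_zero [μ.IsOpenPosMeasure] {k : ℕ} {f : (Fin 2 → ℂ) → ℂ}
    (hf : IsWeightFor τ₁ Q S k f) (hfc : ContinuousOn f ball₂) {z₀ : Fin 2 → ℂ} (hz₀ : z₀ ∈ ball₂)
    (hne : f z₀ ≠ 0) : peterssonInner hQ S hS μ hf hf ≠ 0 := by
  intro h
  have := peterssonInner_self_re_pos hQ S hS μ hf hfc hz₀ hne
  rw [h, Complex.zero_re] at this
  exact lt_irrefl _ this

/-- **Non-degeneracy**: `⟨f, f⟩ = 0` iff `f` vanishes identically on the ball (continuous weight-`k`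
forms, `μ` positive on open sets). -/
theorem peterssonInner_self_eq_zero_iff [μ.IsOpenPosMeasure] {k : ℕ} {f : (Fin 2 → ℂ) → ℂ}
    (hf : IsWeightFor τ₁ Q S k f) (hfc : ContinuousOn f ball₂) :
    peterssonInner hQ S hS μ hf hf = 0 ↔ ∀ z ∈ ball₂, f z = 0 := by
  constructor
  · intro h z hz
    by_contra hne
    exact peterssonInner_self_ne_zero hQ S hS μ hf hfc hz hne h
  · exact peterssonInner_eq_zero_of_forall_eq_zero hQ S hS μ hf hf

end Compact

end Summit.Ventures.HodgeRepro2.ShimuraData
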